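import Literature.NumberTheory.Automorphic.AdelicVectorPlaceSplitting
import HarnessLib

/-!
# `𝔸_K`-linear maps local at a finite place `v` through the place splitting `X(𝔸_K) = X(K_v) × X(𝔸_K)^{(v)}`
# (matrix-free form), and the transport of invariant measures

Topic `NumberTheory/Automorphic`; namespace `Literature.NumberTheory.Automorphic.AdelicVector`.  Sequel to
`AdelicVectorPlaceSplitting` (`evalAt`, `single`, `trivialAt`, `placeSplitting : X(K_v) × trivialAt ≃ₜ+ X(𝔸_K)`).
KERNEL ONLY: theorems; no definition, no named fact, no instance, no `sorry`.

For a number field `K`, a finite index type `ι`, a finite place `v`, `X(𝔸_K) := ι → 𝔸_K`: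
* §1 the idempotent `e_v := ι_v(1) = adeleSingleHom K v 1` of the factor `K_v ⊆ 𝔸_K` cuts out the `v`-component:
  `adeleSingleHom_one_smul` (`e_v • y = single y_v`), `single_eq_adeleSingleHom_one_smul`, `…_smul_eq_zero_of_mem`;
* §2 consequently EVERY `𝔸_K`-linear map `L` of `X(𝔸_K)` respects the splitting: `linearMap_single`
  (`L (single a) = single ((L (single a))_v)`), `linearMap_mem_trivialAt`; and if `L` is LOCAL AT `v` in the sense that it
  fixes `X(𝔸_K)^{(v)} = trivialAt` pointwise, then through the splitting it acts as `L_v × id` with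
  `L_v a := (L (single a))_v`: `evalAt_linearMap_of_forall_mem`, **`placeSplitting_symm_linearMap_of_forall_mem`**,
  `placeSplitting_symm_comp_linearMap_eq` — the matrix-free form of `placeSplitting_symm_mulVec_of_isLocalAt` (no matrix of
  `L` is ever computed; in the application `L` is the geometric action `vDiagAct (inclPlaceAdelic v u)` of a `v`-supported
  element of the unitary group, an `𝔸_F`-linear automorphism of `X□(𝔸_F)`);
* §3 **`map_prodMap_map_placeSplitting_symm`** — INVARIANCE TRANSPORT: if `L_* μ = μ` for a measure `μ` on `X(𝔸_K)` and `L`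
  is local at `v` with measurable local component `L_v`, then `(L_v × id)_* (placeSplitting⁻¹_* μ) = placeSplitting⁻¹_* μ`.

Sources: D. Bump, *Automorphic Forms and Representations* (1997), §3.3 Prop. 3.3.2 (adelic points and Haar measure
componentwise) [Bump1997]; J. W. S. Cassels, A. Fröhlich, *Algebraic Number Theory* (1967), Ch. II §14 (the factor `K_v`
of the restricted product) [CasselsFrohlichANT1967]; A. Weil, *Acta Math.* 113 (1965), Chap. V n° 50, pp. 73–74 (`X_A = X_v × X'`,
invariance of the fibre measures under the `v`-member) [Weil1965].

USE (cell `hodgecm-mathlib`, FLOOR-0 P4, ENGINE E-2, `StubSW2` (iii), I-CLOSE sheet `SW2-ICLOSE-ASSEMBLY.v0` §2 (1) and the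
outer assembly's binder (SPLIT-v ∘ BRIDGE-v)): the `U(J_V)(F_v)`-intertwining clause of
`e := (β_v × id) ∘ placeSplitting⁻¹` and the `GL_N(F_v)`-invariance of the transported fibre measures.
HC_CM is proved only modulo the printed citations until rung 0 closes.
-/

noncomputable section

open MeasureTheory Measure Set Filter Topology IsDedekindDomain NumberField
open scoped ENNReal NNReal Matrix

/-! ## §6 `𝔸_K`-linear maps local at `v`: the matrix-free form (sequel `AdelicVectorPlaceSplittingLinear`) -/

namespace Literature.NumberTheory.Automorphic

namespace AdelicVector

section Linear

variable {K : Type} [Field K] [NumberField K] {ι : Type} {v : HeightOneSpectrum (𝓞 K)}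

/-- components of a product of adeles at a finite place (definitional). [folklore] -/
private theorem adele_snd_mul_apply (x y : AdeleRing (𝓞 K) K) (w : HeightOneSpectrum (𝓞 K)) :
    (x * y).2 w = x.2 w * y.2 w := rfl

/-- archimedean part of a product of adeles (definitional). [folklore] -/
private theorem adele_fst_mul (x y : AdeleRing (𝓞 K) K) : (x * y).1 = x.1 * y.1 := rfl

/-- **The idempotent `e_v := ι_v(1) ∈ 𝔸_K` cuts out the `v`-component**: `e_v • y = single (y_v)` for every
`y ∈ X(𝔸_K)` (Cassels–Fröhlich Ch. II §14: `𝔸 = K_v × 𝔸^{(v)}`, `e_v` the unit of the factor `K_v`).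
[cite: CasselsFrohlichANT1967, Ch. II §14] -/
theorem adeleSingleHom_one_smul (y : ι → AdeleRing (𝓞 K) K) :
    adeleSingleHom K v 1 • y = single K ι v (evalAt K ι v y) := by
  funext i
  rw [Pi.smul_apply, smul_eq_mul, single_apply]
  refine adele_ext ?_ fun w => ?_
  · rw [adele_fst_mul, adeleSingleHom_apply_fst, zero_mul, adeleSingleHom_apply_fst]
  · rw [adele_snd_mul_apply, adeleSingleHom_apply_snd, adeleSingleHom_apply_snd]
    by_cases hwv : w = v
    · subst hwv
      rw [finiteAdeleSingleHom_apply_self, finiteAdeleSingleHom_apply_self, one_mul, evalAt_apply]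
    · rw [finiteAdeleSingleHom_apply_of_ne K v _ hwv, finiteAdeleSingleHom_apply_of_ne K v _ hwv, zero_mul]

/-- `single a = e_v • single a`. [cite: CasselsFrohlichANT1967, Ch. II §14] -/
theorem single_eq_adeleSingleHom_one_smul (a : ι → v.adicCompletion K) :
    single K ι v a = adeleSingleHom K v 1 • single K ι v a := by
  rw [adeleSingleHom_one_smul, evalAt_single]

/-- `e_v` kills the vectors trivial at `v`. [cite: CasselsFrohlichANT1967, Ch. II §14] -/
theorem adeleSingleHom_one_smul_eq_zero_of_mem {h : ι → AdeleRing (𝓞 K) K} (hh : h ∈ trivialAt K ι v) :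
    adeleSingleHom K v 1 • h = 0 := by
  rw [adeleSingleHom_one_smul, evalAt_eq_zero_of_mem hh, map_zero]

/-- **An `𝔸_K`-linear map sends the factor `X(K_v)` into itself**: `L (single a) = single ((L (single a))_v)` — because
`single a = e_v • single a` and `L` commutes with the scalar `e_v` (Bump (1997) §3.3: adelic linear maps act
componentwise). [cite: Bump1997, §3.3 Prop. 3.3.2] -/
theorem linearMap_single (L : (ι → AdeleRing (𝓞 K) K) →ₗ[AdeleRing (𝓞 K) K] (ι → AdeleRing (𝓞 K) K))
    (a : ι → v.adicCompletion K) :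
    L (single K ι v a) = single K ι v (evalAt K ι v (L (single K ι v a))) := by
  conv_lhs => rw [single_eq_adeleSingleHom_one_smul, map_smul]
  exact adeleSingleHom_one_smul _

/-- An `𝔸_K`-linear map preserves `trivialAt` (it commutes with `e_v`, and `trivialAt = ker (e_v • ·)`).
[cite: Bump1997, §3.3 Prop. 3.3.2] -/
theorem linearMap_mem_trivialAt (L : (ι → AdeleRing (𝓞 K) K) →ₗ[AdeleRing (𝓞 K) K] (ι → AdeleRing (𝓞 K) K))
    {h : ι → AdeleRing (𝓞 K) K} (hh : h ∈ trivialAt K ι v) : L h ∈ trivialAt K ι v := by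
  have h1 : adeleSingleHom K v 1 • L h = 0 := by
    rw [← map_smul, adeleSingleHom_one_smul_eq_zero_of_mem hh, map_zero]
  rw [adeleSingleHom_one_smul] at h1
  rw [trivialAt, AddMonoidHom.mem_ker]
  exact single_injective (by rw [h1, map_zero])

/-- **The `v`-component of `L x` depends only on `x_v` when `L` fixes the vectors trivial at `v`**:
`(L x)_v = (L (single x_v))_v`. [cite: Bump1997, §3.3 Prop. 3.3.2] -/
theorem evalAt_linearMap_of_forall_mem (L : (ι → AdeleRing (𝓞 K) K) →ₗ[AdeleRing (𝓞 K) K] (ι → AdeleRing (𝓞 K) K))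
    (hL : ∀ h ∈ trivialAt K ι v, L h = h) (x : ι → AdeleRing (𝓞 K) K) :
    evalAt K ι v (L x) = evalAt K ι v (L (single K ι v (evalAt K ι v x))) := by
  have hx : x = single K ι v (evalAt K ι v x) + (x - single K ι v (evalAt K ι v x)) := by abel
  conv_lhs => rw [hx, map_add, hL _ (sub_single_evalAt_mem x), map_add, evalAt_eq_zero_of_mem (sub_single_evalAt_mem x),
    add_zero]

/-- **Through the splitting, an `𝔸_K`-linear map LOCAL AT `v` (i.e. fixing `X(𝔸_K)^{(v)}` pointwise) acts as `L_v × id`**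
with `L_v a := (L (single a))_v`: `placeSplitting⁻¹ (L x) = (L_v x_v, (placeSplitting⁻¹ x).2)` — the matrix-free form of
`placeSplitting_symm_mulVec_of_isLocalAt` (Weil (1965) n° 50: the `v`-member of the dual pair acts on the factor `X_v` of
`X_A = X_v × X'`). [cite: Bump1997, §3.3 Prop. 3.3.2] -/
theorem placeSplitting_symm_linearMap_of_forall_mem
    (L : (ι → AdeleRing (𝓞 K) K) →ₗ[AdeleRing (𝓞 K) K] (ι → AdeleRing (𝓞 K) K))
    (hL : ∀ h ∈ trivialAt K ι v, L h = h) (x : ι → AdeleRing (𝓞 K) K) :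
    (placeSplitting K ι v).symm (L x) =
      (evalAt K ι v (L (single K ι v (evalAt K ι v x))), ((placeSplitting K ι v).symm x).2) := by
  set p := (placeSplitting K ι v).symm x with hp
  have hx : x = single K ι v p.1 + (p.2 : ι → AdeleRing (𝓞 K) K) := by
    rw [← placeSplitting_apply, hp, ContinuousAddEquiv.apply_symm_apply]
  have hp1 : p.1 = evalAt K ι v x := rfl
  apply (placeSplitting K ι v).injective
  rw [ContinuousAddEquiv.apply_symm_apply, placeSplitting_apply]
  change L x = single K ι v (evalAt K ι v (L (single K ι v (evalAt K ι v x)))) + (p.2 : ι → AdeleRing (𝓞 K) K)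
  conv_lhs => rw [hx, map_add, hL _ p.2.2, linearMap_single L p.1, hp1]

/-- The same with the local operator named: if `L_v : X(K_v) → X(K_v)` satisfies `(L (single a))_v = L_v a`, then
`placeSplitting⁻¹ ∘ L = (L_v × id) ∘ placeSplitting⁻¹`. [cite: Bump1997, §3.3 Prop. 3.3.2] -/
theorem placeSplitting_symm_comp_linearMap_eq
    (L : (ι → AdeleRing (𝓞 K) K) →ₗ[AdeleRing (𝓞 K) K] (ι → AdeleRing (𝓞 K) K))
    (hL : ∀ h ∈ trivialAt K ι v, L h = h) (Lv : (ι → v.adicCompletion K) → (ι → v.adicCompletion K))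
    (hLv : ∀ a, evalAt K ι v (L (single K ι v a)) = Lv a) :
    (placeSplitting K ι v).symm ∘ L = Prod.map Lv id ∘ (placeSplitting K ι v).symm := by
  funext x
  rw [Function.comp_apply, Function.comp_apply, placeSplitting_symm_linearMap_of_forall_mem L hL x, hLv]
  rfl

variable [Fintype ι] [MeasurableSpace (AdeleRing (𝓞 K) K)] [BorelSpace (AdeleRing (𝓞 K) K)]
  [MeasurableSpace (v.adicCompletion K)] [BorelSpace (v.adicCompletion K)]

/-- **INVARIANCE TRANSPORT**: if a measure `μ` on `X(𝔸_K)` is invariant under an `𝔸_K`-linear map `L` local at `v`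
(`L` fixes `X(𝔸_K)^{(v)}` pointwise) with measurable local component `L_v`, then the transported measure
`(placeSplitting⁻¹)_* μ` on `X(K_v) × X(𝔸_K)^{(v)}` is invariant under `L_v × id` (Weil (1965) n° 50: invariance of the
fibre measures under the `v`-member read on `X_v × X'`). [cite: Weil1965, Chap. V n° 50, pp. 73–74] -/
theorem map_prodMap_map_placeSplitting_symm
    (L : (ι → AdeleRing (𝓞 K) K) →ₗ[AdeleRing (𝓞 K) K] (ι → AdeleRing (𝓞 K) K))
    (hL : ∀ h ∈ trivialAt K ι v, L h = h) (Lv : (ι → v.adicCompletion K) → (ι → v.adicCompletion K))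
    (hLvm : Measurable Lv) (hLv : ∀ a, evalAt K ι v (L (single K ι v a)) = Lv a)
    (μ : Measure (ι → AdeleRing (𝓞 K) K)) (hμ : Measure.map L μ = μ) :
    Measure.map (Prod.map Lv id) (Measure.map (placeSplitting K ι v).symm μ) =
      Measure.map (placeSplitting K ι v).symm μ := by
  haveI := secondCountableTopology_adeleRing (K := K)
  haveI := secondCountableTopology_adicCompletion K v
  haveI : Countable ι := Finite.to_countable
  haveI := secondCountableTopology_pi K ι
  haveI := secondCountableTopology_piLocal K ι v
  haveI := secondCountableTopology_trivialAt K ι v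
  haveI : BorelSpace (ι → AdeleRing (𝓞 K) K) := Pi.borelSpace
  haveI : BorelSpace (ι → v.adicCompletion K) := Pi.borelSpace
  haveI : BorelSpace (trivialAt K ι v) := Subtype.borelSpace _
  haveI : BorelSpace ((ι → v.adicCompletion K) × trivialAt K ι v) := Prod.borelSpace
  have hLc : Continuous L := by
    haveI : ContinuousSMul (AdeleRing (𝓞 K) K) (AdeleRing (𝓞 K) K) := ⟨continuous_mul⟩
    exact L.continuous_on_pi
  have he : Measurable ((placeSplitting K ι v).symm : (ι → AdeleRing (𝓞 K) K) → _) :=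
    (placeSplitting K ι v).symm.continuous.measurable
  have hP : Measurable (Prod.map Lv (id : trivialAt K ι v → trivialAt K ι v)) := hLvm.prodMap measurable_id
  rw [Measure.map_map hP he, ← placeSplitting_symm_comp_linearMap_eq L hL Lv hLv, ← Measure.map_map he hLc.measurable, hμ]

end Linear

end AdelicVector

end Literature.NumberTheory.Automorphic
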